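import Mathlib.Data.Finset.Card
import Mathlib.Data.Finset.Image
import Mathlib.Data.Finset.Union
import Mathlib.Data.Fintype.Basic
import Mathlib.Logic.Relation
import HarnessLib

/-!
# Counting connectivity classes of a relation on a finite set; gluing along a shared block

Topic `Literature/Probability/LatticeModels`. Elementary bookkeeping for the number of open clusters in
the contour representation of the random-cluster model (Grimmett 2006, §7.5; the cluster-count part of
the Hamiltonian decomposition (7.28) of Friedli–Velenik): for a relation `R` and a finite set `U`,
`cls R U x` is the set of points of `U` chained to `x` by `R`-steps inside `U` and `ccount R U` the number
of such classes. We prove: monotonicity in `R`, the count of the empty relation and of a connected set,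
additivity over `R`-separated disjoint unions, invariance under adding relations inside one class
(wiring a block that is already connected), and the **gluing formula**: if `U = U₁ ∪ U₂` with
`U₁ ∩ U₂ = L` non-empty, no `R`-step joins `U₁ ∖ L` to `U₂ ∖ L`, and `L` lies inside one class of `U₁`
and one class of `U₂`, then `ccount U + 1 = ccount U₁ + ccount U₂`.

Everything is proved; no named facts.

## References

* G. Grimmett, *The Random-Cluster Model*, Springer 2006, §7.5 (cluster counts in the contour
  representation, eqs. (7.18)–(7.22)). [Grimmett2006]
* S. Friedli, Y. Velenik, *Statistical Mechanics of Lattice Systems*, CUP 2017, §7.3, eq. (7.28).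
  [FriedliVelenik2017]
-/

noncomputable section

open Finset Relation

namespace Literature.Probability.LatticeModels

namespace ClassCount

variable {α : Type*} [DecidableEq α]

/-- The relation `R` restricted to steps inside `U`. [folklore] -/
def relIn (R : α → α → Prop) (U : Finset α) (a b : α) : Prop := R a b ∧ a ∈ U ∧ b ∈ U

/-- The class of `x`: the points of `U` chained to `x` by `R`-steps inside `U`. [cite: Grimmett2006, §7.5 (open clusters)] -/
def cls (R : α → α → Prop) (U : Finset α) (x : α) : Finset α :=
  by classical exact U.filter fun y => ReflTransGen (relIn R U) x y

/-- **The number of classes** of `R` inside `U`. [cite: Grimmett2006, §7.5 (k(ω))] -/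
def ccount (R : α → α → Prop) (U : Finset α) : ℕ := #(U.image (cls R U))

variable {R R' : α → α → Prop} {U : Finset α}

omit [DecidableEq α] in
/-- Membership in a class. [folklore] -/
theorem mem_cls {x y : α} : y ∈ cls R U x ↔ y ∈ U ∧ ReflTransGen (relIn R U) x y := by
  classical
  rw [cls, mem_filter]

omit [DecidableEq α] in
/-- The end of a chain inside `U` from a point of `U` lies in `U`. [folklore] -/
theorem mem_of_reflTransGen {x y : α} (h : ReflTransGen (relIn R U) x y) (hx : x ∈ U) : y ∈ U := by
  induction h with
  | refl => exact hx
  | tail _ hbc _ => exact hbc.2.2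

omit [DecidableEq α] in
/-- A point of `U` lies in its class. [folklore] -/
theorem mem_cls_self {x : α} (hx : x ∈ U) : x ∈ cls R U x := mem_cls.2 ⟨hx, ReflTransGen.refl⟩

omit [DecidableEq α] in
/-- Classes are subsets of `U`. [folklore] -/
theorem cls_subset (x : α) : cls R U x ⊆ U := fun _ hy => (mem_cls.1 hy).1

omit [DecidableEq α] in
/-- Chains of a symmetric relation can be reversed. [folklore] -/
theorem reflTransGen_symm (hR : ∀ a b, R a b → R b a) {x y : α} (h : ReflTransGen (relIn R U) x y) : ReflTransGen (relIn R U) y x := by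
  induction h with
  | refl => exact ReflTransGen.refl
  | tail _ hbc ih => exact ReflTransGen.head ⟨hR _ _ hbc.1, hbc.2.2, hbc.2.1⟩ ih

omit [DecidableEq α] in
/-- **Classes through chained points coincide** (symmetric `R`). [folklore] -/
theorem cls_eq_of_mem (hR : ∀ a b, R a b → R b a) {x y : α} (hy : y ∈ cls R U x) : cls R U y = cls R U x := by
  obtain ⟨-, hxy⟩ := mem_cls.1 hy
  ext z
  rw [mem_cls, mem_cls]
  exact ⟨fun ⟨hz, h⟩ => ⟨hz, hxy.trans h⟩, fun ⟨hz, h⟩ => ⟨hz, (reflTransGen_symm hR hxy).trans h⟩⟩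

omit [DecidableEq α] in
/-- Monotonicity of chains in the relation. [folklore] -/
theorem reflTransGen_mono (h : ∀ a ∈ U, ∀ b ∈ U, R a b → R' a b) {x y : α} (hxy : ReflTransGen (relIn R U) x y) :
    ReflTransGen (relIn R' U) x y := by
  induction hxy with
  | refl => exact ReflTransGen.refl
  | tail _ hbc ih => exact ih.tail ⟨h _ hbc.2.1 _ hbc.2.2 hbc.1, hbc.2.1, hbc.2.2⟩

omit [DecidableEq α] in
/-- Classes grow with the relation. [folklore] -/
theorem cls_subset_cls (h : ∀ a ∈ U, ∀ b ∈ U, R a b → R' a b) (x : α) : cls R U x ⊆ cls R' U x := fun _ hy =>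
  mem_cls.2 ⟨(mem_cls.1 hy).1, reflTransGen_mono h (mem_cls.1 hy).2⟩

/-- **More relations, fewer classes.** [folklore] -/
theorem ccount_anti (hR' : ∀ a b, R' a b → R' b a) (h : ∀ a ∈ U, ∀ b ∈ U, R a b → R' a b) : ccount R' U ≤ ccount R U := by
  classical
  -- the `R'`-class is a function of the `R`-class
  have key : U.image (cls R' U) = (U.image (cls R U)).image fun C => C.biUnion (cls R' U) := by
    rw [image_image]
    refine image_congr fun x hx => ?_
    simp only [Function.comp_apply]
    ext z
    rw [mem_biUnion]
    constructor
    · intro hz; exact ⟨x, mem_cls_self (mem_coe.1 hx), hz⟩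
    · rintro ⟨y, hy, hz⟩
      rw [cls_eq_of_mem hR' (cls_subset_cls h x hy)] at hz
      exact hz
  rw [ccount, ccount, key]
  exact card_image_le

/-- **The empty relation has `|U|` classes** (every point is its own class). [cite: Grimmett2006, §7.5] -/
theorem ccount_eq_card_of_forall_not (h : ∀ a ∈ U, ∀ b ∈ U, ¬ R a b) : ccount R U = #U := by
  classical
  rw [ccount]
  have hcls : ∀ x ∈ U, cls R U x = {x} := by
    intro x hx
    refine eq_singleton_iff_unique_mem.2 ⟨mem_cls_self hx, fun y hy => ?_⟩
    obtain ⟨-, hxy⟩ := mem_cls.1 hy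
    induction hxy with
    | refl => rfl
    | tail _ hbc _ => exact absurd hbc.1 (h _ hbc.2.1 _ hbc.2.2)
  rw [image_congr (show Set.EqOn (cls R U) (fun x => {x}) ↑U from fun x hx => hcls x (mem_coe.1 hx)),
    card_image_of_injective _ singleton_injective]

/-- **A connected non-empty set has one class.** [cite: Grimmett2006, §7.5] -/
theorem ccount_eq_one (hU : U.Nonempty) (h : ∀ a ∈ U, ∀ b ∈ U, ReflTransGen (relIn R U) a b) : ccount R U = 1 := by
  classical
  rw [ccount, card_eq_one]
  obtain ⟨x₀, hx₀⟩ := hU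
  refine ⟨U, eq_singleton_iff_unique_mem.2 ⟨mem_image.2 ⟨x₀, hx₀, ?_⟩, fun C hC => ?_⟩⟩
  · ext z; rw [mem_cls]; exact ⟨fun hz => hz.1, fun hz => ⟨hz, h x₀ hx₀ z hz⟩⟩
  · obtain ⟨x, hx, rfl⟩ := mem_image.1 hC
    ext z; rw [mem_cls]; exact ⟨fun hz => hz.1, fun hz => ⟨hz, h x hx z hz⟩⟩

/-- The empty set has no classes. [folklore] -/
theorem ccount_empty : ccount R (∅ : Finset α) = 0 := by
  classical
  rw [ccount, image_empty, card_empty]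

/-! ### First exit from a subset -/

/-- **First-exit lemma**: if a chain inside `U` from a point of `P` cannot be realised inside `U ∩ P`,
then some `p ∈ P` reached inside `U ∩ P` is related to some `v ∈ U ∖ P` from which the chain continues.
[folklore] -/
theorem exists_first_exit {P : Finset α} {a b : α} (h : ReflTransGen (relIn R U) a b) (ha : a ∈ P)
    (hb : ¬ ReflTransGen (relIn R (U ∩ P)) a b) :
    ∃ p v, p ∈ P ∧ v ∉ P ∧ relIn R U p v ∧ ReflTransGen (relIn R (U ∩ P)) a p ∧ ReflTransGen (relIn R U) v b := by
  induction h using ReflTransGen.head_induction_on with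
  | refl => exact absurd ReflTransGen.refl hb
  | head hac hcb ih =>
    rename_i a' c
    by_cases hc : c ∈ P
    · have hstep : relIn R (U ∩ P) a' c := ⟨hac.1, mem_inter.2 ⟨hac.2.1, ha⟩, mem_inter.2 ⟨hac.2.2, hc⟩⟩
      obtain ⟨p, v, hp, hv, hpv, hcp, hvb⟩ := ih hc fun h => hb (ReflTransGen.head hstep h)
      exact ⟨p, v, hp, hv, hpv, ReflTransGen.head hstep hcp, hvb⟩
    · exact ⟨a', c, ha, hc, hac, ReflTransGen.refl, hcb⟩

omit [DecidableEq α] in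
/-- Chains inside a subset are chains inside the set. [folklore] -/
theorem reflTransGen_of_subset {V : Finset α} (hVU : V ⊆ U) {x y : α} (h : ReflTransGen (relIn R V) x y) :
    ReflTransGen (relIn R U) x y := by
  induction h with
  | refl => exact ReflTransGen.refl
  | tail _ hbc ih => exact ih.tail ⟨hbc.1, hVU hbc.2.1, hVU hbc.2.2⟩

/-- A chain inside `U` that never uses a step leaving `V ⊆ U` (no `R`-step from `V` to `U ∖ V`) and starts
in `V` stays in `V`. [folklore] -/
theorem reflTransGen_restrict {V : Finset α} (hVU : V ⊆ U) (hsep : ∀ a ∈ V, ∀ b ∈ U, b ∉ V → ¬ R a b) {x y : α}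
    (hx : x ∈ V) (h : ReflTransGen (relIn R U) x y) : ReflTransGen (relIn R V) x y := by
  classical
  by_contra hno
  have hno' : ¬ ReflTransGen (relIn R (U ∩ V)) x y := by rwa [inter_eq_right.2 hVU]
  obtain ⟨p, v, hp, hv, hpv, -, -⟩ := exists_first_exit h hx hno'
  exact hsep p hp v hpv.2.2 hv hpv.1

/-! ### Additivity over separated unions -/

/-- Inside a separated part, the classes of the union are the classes of the part. [folklore] -/
theorem cls_union_eq_of_separated {U₁ U₂ : Finset α} (hsep : ∀ a ∈ U₁, ∀ b ∈ U₂, ¬ R a b ∧ ¬ R b a)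
    {x : α} (hx : x ∈ U₁) : cls R (U₁ ∪ U₂) x = cls R U₁ x := by
  ext z
  rw [mem_cls, mem_cls]
  constructor
  · rintro ⟨-, h⟩
    have h' := reflTransGen_restrict subset_union_left (fun a ha b hb hbV hab => ?_) hx h
    · exact ⟨mem_of_reflTransGen h' hx, h'⟩
    · rcases mem_union.1 hb with hb | hb
      · exact hbV hb
      · exact (hsep a ha b hb).1 hab
  · rintro ⟨hz, h⟩
    exact ⟨mem_union_left _ hz, reflTransGen_of_subset subset_union_left h⟩

/-- **Additivity of the number of classes over an `R`-separated disjoint union.**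
[cite: Grimmett2006, §7.5 (k(ω) is additive over non-communicating regions)] -/
theorem ccount_union_of_separated {U₁ U₂ : Finset α} (hsep : ∀ a ∈ U₁, ∀ b ∈ U₂, ¬ R a b ∧ ¬ R b a)
    (hdis : Disjoint U₁ U₂) : ccount R (U₁ ∪ U₂) = ccount R U₁ + ccount R U₂ := by
  classical
  have hsep' : ∀ a ∈ U₂, ∀ b ∈ U₁, ¬ R a b ∧ ¬ R b a := fun a ha b hb => ⟨(hsep b hb a ha).2, (hsep b hb a ha).1⟩
  rw [ccount, ccount, ccount, image_union]
  rw [image_congr (show Set.EqOn (cls R (U₁ ∪ U₂)) (cls R U₁) ↑U₁ from fun x hx => cls_union_eq_of_separated hsep (mem_coe.1 hx)),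
    image_congr (show Set.EqOn (cls R (U₁ ∪ U₂)) (cls R U₂) ↑U₂ from fun x hx => by
      rw [union_comm]; exact cls_union_eq_of_separated hsep' (mem_coe.1 hx))]
  refine card_union_of_disjoint (Finset.disjoint_left.2 fun C hC₁ hC₂ => ?_)
  obtain ⟨x, hx, rfl⟩ := mem_image.1 hC₁
  obtain ⟨y, hy, hxy⟩ := mem_image.1 hC₂
  have hxmem : x ∈ cls R U₂ y := hxy ▸ mem_cls_self hx
  exact Finset.disjoint_left.1 hdis hx (cls_subset y hxmem)

/-! ### Wiring a block that is already connected -/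

/-- The relation `R` together with all steps inside the block `L` ("wiring" `L`). [cite: Grimmett2006, §1.2 and §4.2 (wired boundary conditions)] -/
def wire (R : α → α → Prop) (L : Finset α) (a b : α) : Prop := R a b ∨ (a ∈ L ∧ b ∈ L)

omit [DecidableEq α] in
/-- Wiring only adds relations. [folklore] -/
theorem le_wire (R : α → α → Prop) (L : Finset α) : ∀ a b, R a b → wire R L a b := fun _ _ h => Or.inl h

omit [DecidableEq α] in
/-- Wiring preserves symmetry. [folklore] -/
theorem wire_symm (hR : ∀ a b, R a b → R b a) (L : Finset α) : ∀ a b, wire R L a b → wire R L b a :=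
  fun _ _ h => h.elim (fun h => Or.inl (hR _ _ h)) fun h => Or.inr ⟨h.2, h.1⟩

omit [DecidableEq α] in
/-- **Wiring a block lying inside one class does not change the classes.** [cite: Grimmett2006, §4.2 (wiring a connected set)] -/
theorem cls_wire_eq {L : Finset α} (hL : ∀ a ∈ L, ∀ b ∈ L, ReflTransGen (relIn R U) a b) (x : α) :
    cls (wire R L) U x = cls R U x := by
  refine Subset.antisymm (fun z hz => ?_) (cls_subset_cls (fun a _ b _ h => Or.inl h) x)
  obtain ⟨hzU, h⟩ := mem_cls.1 hz
  have key : ∀ w, ReflTransGen (relIn (wire R L) U) x w → ReflTransGen (relIn R U) x w := by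
    intro w hw
    induction hw with
    | refl => exact ReflTransGen.refl
    | tail _ hbc ih =>
      rcases hbc.1 with h | h
      · exact ih.tail ⟨h, hbc.2.1, hbc.2.2⟩
      · exact ih.trans (hL _ h.1 _ h.2)
  exact mem_cls.2 ⟨hzU, key z h⟩

/-- **Wiring a block lying inside one class does not change the number of classes.** [cite: Grimmett2006, §4.2] -/
theorem ccount_wire_eq {L : Finset α} (hL : ∀ a ∈ L, ∀ b ∈ L, ReflTransGen (relIn R U) a b) :
    ccount (wire R L) U = ccount R U := by
  classical
  rw [ccount, ccount, image_congr fun x _ => cls_wire_eq hL x]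

/-! ### Gluing along a shared block -/

/-- Off the class of the shared block, the classes of one part are classes of the union. [folklore] -/
theorem cls_union_eq_of_not_mem {V W L : Finset α} (hsep : ∀ a ∈ V, a ∉ L → ∀ b ∈ W, b ∉ L → ¬ R a b ∧ ¬ R b a)
    (hLV : L ⊆ V) (hVL : ∀ a ∈ L, ∀ b ∈ L, ReflTransGen (relIn R V) a b) {ℓ : α} (hℓ : ℓ ∈ L)
    {x : α} (hx : x ∈ V) (hxℓ : ℓ ∉ cls R V x) : cls R (V ∪ W) x = cls R V x := by
  classical
  refine Subset.antisymm (fun z hz => ?_)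
    (fun z hz => mem_cls.2 ⟨mem_union_left _ (mem_cls.1 hz).1, reflTransGen_of_subset subset_union_left (mem_cls.1 hz).2⟩)
  obtain ⟨-, h⟩ := mem_cls.1 hz
  by_contra hzV
  have hno : ¬ ReflTransGen (relIn R ((V ∪ W) ∩ V)) x z := by
    rw [inter_eq_right.2 subset_union_left]
    exact fun h' => hzV (mem_cls.2 ⟨mem_of_reflTransGen h' hx, h'⟩)
  obtain ⟨p, v, hp, hv, hpv, hxp, -⟩ := exists_first_exit h hx hno
  rw [inter_eq_right.2 subset_union_left] at hxp
  have hvW : v ∈ W := (mem_union.1 hpv.2.2).resolve_left hv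
  have hvL : v ∉ L := fun h' => hv (hLV h')
  have hpL : p ∈ L := by
    by_contra hpL
    exact (hsep p hp hpL v hvW hvL).1 hpv.1
  exact hxℓ (mem_cls.2 ⟨hLV hℓ, hxp.trans (hVL p hpL ℓ hℓ)⟩)

/-- **The gluing formula**: let `U₁ ∩ U₂ ⊆ L ⊆ U₁ ∩ U₂`-block be non-empty (`U₁ ∩ U₂ = L`), suppose no
`R`-step joins `U₁ ∖ L` and `U₂ ∖ L` (in either direction) and `L` lies inside one class of `(R, U₁)` and
inside one class of `(R, U₂)`. Then `ccount R (U₁ ∪ U₂) + 1 = ccount R U₁ + ccount R U₂` (symmetric `R`).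
[cite: Grimmett2006, §7.5, eqs. (7.18)–(7.21) (cluster counts under cutting along a contour)] -/
theorem ccount_union_add_one (hR : ∀ a b, R a b → R b a) {U₁ U₂ L : Finset α} (hL : U₁ ∩ U₂ = L) (hLne : L.Nonempty)
    (hsep : ∀ a ∈ U₁, a ∉ L → ∀ b ∈ U₂, b ∉ L → ¬ R a b ∧ ¬ R b a)
    (hL₁ : ∀ a ∈ L, ∀ b ∈ L, ReflTransGen (relIn R U₁) a b) (hL₂ : ∀ a ∈ L, ∀ b ∈ L, ReflTransGen (relIn R U₂) a b) :
    ccount R (U₁ ∪ U₂) + 1 = ccount R U₁ + ccount R U₂ := by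
  classical
  obtain ⟨ℓ, hℓ⟩ := hLne
  have hLU₁ : L ⊆ U₁ := fun a ha => (mem_inter.1 (hL.symm ▸ ha : a ∈ U₁ ∩ U₂)).1
  have hLU₂ : L ⊆ U₂ := fun a ha => (mem_inter.1 (hL.symm ▸ ha : a ∈ U₁ ∩ U₂)).2
  have hsep' : ∀ a ∈ U₂, a ∉ L → ∀ b ∈ U₁, b ∉ L → ¬ R a b ∧ ¬ R b a :=
    fun a ha haL b hb hbL => ⟨(hsep b hb hbL a ha haL).2, (hsep b hb hbL a ha haL).1⟩
  set U := U₁ ∪ U₂ with hU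
  set C₁ := cls R U₁ ℓ with hC₁
  set C₂ := cls R U₂ ℓ with hC₂
  have claim1 : ∀ x ∈ U₁, ℓ ∉ cls R U₁ x → cls R U x = cls R U₁ x := fun x hx hxℓ =>
    cls_union_eq_of_not_mem hsep hLU₁ hL₁ hℓ hx hxℓ
  have claim2 : ∀ x ∈ U₂, ℓ ∉ cls R U₂ x → cls R U x = cls R U₂ x := fun x hx hxℓ => by
    rw [hU, union_comm]
    exact cls_union_eq_of_not_mem hsep' hLU₂ hL₂ hℓ hx hxℓ
  -- symmetry of membership in classes
  have hsymm : ∀ (V : Finset α) (x y : α), x ∈ cls R V y → y ∈ cls R V x := fun V x y h =>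
    mem_cls.2 ⟨by
      obtain ⟨hx, hyx⟩ := mem_cls.1 h
      -- `y ∈ V` unless the chain is trivial
      induction hyx using ReflTransGen.head_induction_on with
      | refl => exact hx
      | head hac _ _ => exact hac.2.1, reflTransGen_symm hR (mem_cls.1 h).2⟩
  -- the class of `ℓ` in `U`
  have hD : cls R U ℓ = C₁ ∪ C₂ := by
    refine Subset.antisymm (fun z hz => ?_) (union_subset
      (fun z hz => mem_cls.2 ⟨mem_union_left _ (mem_cls.1 hz).1, reflTransGen_of_subset subset_union_left (mem_cls.1 hz).2⟩)
      (fun z hz => mem_cls.2 ⟨mem_union_right _ (mem_cls.1 hz).1, reflTransGen_of_subset subset_union_right (mem_cls.1 hz).2⟩))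
    have hzU := (mem_cls.1 hz).1
    by_contra hzD
    rw [mem_union, not_or] at hzD
    rcases mem_union.1 hzU with hz₁ | hz₂
    · have hℓz : ℓ ∉ cls R U₁ z := fun h => hzD.1 (hsymm U₁ ℓ z h)
      have := hsymm U z ℓ hz
      rw [claim1 z hz₁ hℓz] at this
      exact hℓz this
    · have hℓz : ℓ ∉ cls R U₂ z := fun h => hzD.2 (hsymm U₂ ℓ z h)
      have := hsymm U z ℓ hz
      rw [claim2 z hz₂ hℓz] at this
      exact hℓz this
  -- the family of classes of `U`
  have hC₁mem : C₁ ∈ U₁.image (cls R U₁) := mem_image_of_mem _ (hLU₁ hℓ)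
  have hC₂mem : C₂ ∈ U₂.image (cls R U₂) := mem_image_of_mem _ (hLU₂ hℓ)
  have hℓC : ∀ (V : Finset α) (x : α), ℓ ∈ cls R V x → cls R V x = cls R V ℓ := fun V x h => (cls_eq_of_mem hR h).symm
  have hfam : U.image (cls R U) = insert (C₁ ∪ C₂) (((U₁.image (cls R U₁)).erase C₁) ∪ ((U₂.image (cls R U₂)).erase C₂)) := by
    ext C
    rw [mem_image, mem_insert, mem_union, mem_erase, mem_erase, mem_image, mem_image]
    constructor
    · rintro ⟨x, hx, rfl⟩
      by_cases hℓx : ℓ ∈ cls R U x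
      · left; rw [hℓC U x hℓx, hD]
      · right
        rcases mem_union.1 hx with hx₁ | hx₂
        · have hℓx₁ : ℓ ∉ cls R U₁ x := fun h => hℓx (cls_subset_cls (fun _ _ _ _ h => h) x
            (mem_cls.2 ⟨mem_union_left _ (mem_cls.1 h).1, reflTransGen_of_subset subset_union_left (mem_cls.1 h).2⟩))
          left
          refine ⟨fun h => hℓx₁ ?_, x, hx₁, (claim1 x hx₁ hℓx₁).symm⟩
          rw [← claim1 x hx₁ hℓx₁, h]; exact mem_cls_self (hLU₁ hℓ)
        · have hℓx₂ : ℓ ∉ cls R U₂ x := fun h => hℓx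
            (mem_cls.2 ⟨mem_union_right _ (mem_cls.1 h).1, reflTransGen_of_subset subset_union_right (mem_cls.1 h).2⟩)
          right
          refine ⟨fun h => hℓx₂ ?_, x, hx₂, (claim2 x hx₂ hℓx₂).symm⟩
          rw [← claim2 x hx₂ hℓx₂, h]; exact mem_cls_self (hLU₂ hℓ)
    · rintro (rfl | ⟨hne, x, hx, rfl⟩ | ⟨hne, x, hx, rfl⟩)
      · exact ⟨ℓ, mem_union_left _ (hLU₁ hℓ), hD⟩
      · have hℓx : ℓ ∉ cls R U₁ x := fun h => hne (hℓC U₁ x h)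
        exact ⟨x, mem_union_left _ hx, claim1 x hx hℓx⟩
      · have hℓx : ℓ ∉ cls R U₂ x := fun h => hne (hℓC U₂ x h)
        exact ⟨x, mem_union_right _ hx, claim2 x hx hℓx⟩
  -- counting
  have hnot : C₁ ∪ C₂ ∉ ((U₁.image (cls R U₁)).erase C₁) ∪ ((U₂.image (cls R U₂)).erase C₂) := by
    intro h
    have hℓD : ℓ ∈ C₁ ∪ C₂ := mem_union_left _ (mem_cls_self (hLU₁ hℓ))
    rcases mem_union.1 h with h | h
    · obtain ⟨hne, hmem⟩ := mem_erase.1 h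
      obtain ⟨x, -, hx⟩ := mem_image.1 hmem
      rw [← hx] at hℓD
      exact hne (hx.symm.trans (hℓC U₁ x hℓD))
    · obtain ⟨hne, hmem⟩ := mem_erase.1 h
      obtain ⟨x, -, hx⟩ := mem_image.1 hmem
      rw [← hx] at hℓD
      exact hne (hx.symm.trans (hℓC U₂ x hℓD))
  have hdisj : Disjoint ((U₁.image (cls R U₁)).erase C₁) ((U₂.image (cls R U₂)).erase C₂) := by
    rw [Finset.disjoint_left]
    intro C h₁ h₂
    obtain ⟨hne₁, h₁⟩ := mem_erase.1 h₁
    obtain ⟨-, h₂⟩ := mem_erase.1 h₂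
    obtain ⟨x, hx, rfl⟩ := mem_image.1 h₁
    obtain ⟨y, hy, hxy⟩ := mem_image.1 h₂
    -- `C ⊆ U₁ ∩ U₂ = L`, non-empty, hence meets `C₁`
    have hxC : x ∈ cls R U₁ x := mem_cls_self hx
    have hxU₂ : x ∈ U₂ := cls_subset y (hxy ▸ hxC)
    have hxL : x ∈ L := hL ▸ mem_inter.2 ⟨hx, hxU₂⟩
    exact hne₁ (hℓC U₁ x (mem_cls.2 ⟨hLU₁ hℓ, hL₁ x hxL ℓ hℓ⟩))
  rw [ccount, ccount, ccount, hfam, card_insert_of_notMem hnot, card_union_of_disjoint hdisj,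
    card_erase_of_mem hC₁mem, card_erase_of_mem hC₂mem]
  have h1 : 1 ≤ #(U₁.image (cls R U₁)) := card_pos.2 ⟨_, hC₁mem⟩
  have h2 : 1 ≤ #(U₂.image (cls R U₂)) := card_pos.2 ⟨_, hC₂mem⟩
  omega

end ClassCount

end Literature.Probability.LatticeModels

end
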